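import Mathlib.Algebra.Order.BigOperators.Ring.Finset
import Mathlib.Data.Real.Basic
import Mathlib.Data.Fintype.Prod
import Mathlib.Data.Fintype.BigOperators
import Mathlib.Order.Monotone.Basic
import Mathlib.Tactic.Linarith
import Mathlib.Tactic.LinearCombination
import Mathlib.Tactic.Positivity
import Mathlib.Tactic.Ring
import HarnessLib

/-!
# Kahn's third-order inequality under MODULE EXTENSIONS — preliminaries
# (lineage `prim-master-conj`, gen 55; `--supports stmt-CriticalPhenomena-4575`)

Support file of the `prim-master-conj` lineage (crux `NoHeavyLowerTail`, stmt-CriticalPhenomena-4575).  Nothing here asserts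
Kahn's Conjecture 5 / Sahi's `C₃`; we prove an infinite family of its instances.

## Setting (finite weighted posets)

A *weighted poset* is a finite preorder `X` with a weight `w : X → ℝ`; `ex w f = Σ_x w x · f x` is the expectation.
`IsProbWeight w` (nonnegative, total mass `1`), `IsHarris w` (Harris' inequality: `E f · E g ≤ E (f g)` for monotone `f, g`).
Sahi's third-order functional of three functions is
`kahnK w f g h = 2E(fgh) − E(fg)E(h) − E(fh)E(g) − E(gh)E(f) + E(f)E(g)E(h)` [Sahi 2008, eq. (7); Lieb–Sahi 2021, (2.1)], and
`KahnPair w g h` says `kahnK w f g h ≥ 0` for EVERY monotone `f ≥ 0` ("Kahn's inequality for the pair `(g,h)` against all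
increasing test functions" — for indicators `g = 1_B, h = 1_C` this is Kahn's Conjecture 5 [Kahn 2022] for the pair `(B,C)` and
all increasing `A`, by linearity in `f`).

## Contents (all proved)

* bookkeeping: `ex` on a product `X × Y` with the product weight `prodW w w'` is an iterated expectation (`ex_prodW`);
  monotonicity of fibres and of fibre expectations;
* `isHarris_prodW` — the product of two Harris probability spaces is Harris (the classical induction step of Harris 1960 /
  Kleitman 1966, written for arbitrary finite weighted preorders); `isHarris_bool` — a two-point space is Harris;
* `kahnK` symmetries, `kahnPair_of_le` — the NESTED case `g ≤ h` (and `h ≤ g`) of Kahn's inequality holds on every Harris space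
  [the printed nested/principal mechanism, cf. `Literature.Probability.LatticeModels.SahiThirdOrderCorrelation`], and the trivial
  pairs `(0,h)`, `(1,h)`.

The module-extension theorems (`B ↦ B ∧ V`, `B ∨ V` with `V` on fresh coordinates, jointly or on one side) are in
`…SahiMasterFamilyKahnModule`.  Design: functions `X → ℝ` with `IsIndicator` (values in `{0,1}`) instead of sets, so that all
identities are polynomial; preorders instead of Boolean cubes, so that the induction "old cube × fresh module" is literally a
product of types.
-/

open Finset
open scoped BigOperators

namespace Summit.CriticalPhenomena.PercolationContinuityZ3.Theorems.SahiKahnModule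

variable {X Y : Type*} [Fintype X] [Fintype Y]

/-! ## Expectations, probability weights, Harris spaces -/

/-- Expectation of `f` under the weight `w`: `Σ_x w x · f x`. [this work] -/
def ex (w : X → ℝ) (f : X → ℝ) : ℝ := ∑ x, w x * f x

/-- A probability weight: nonnegative with total mass `1`. [this work] -/
structure IsProbWeight (w : X → ℝ) : Prop where
  nonneg : ∀ x, 0 ≤ w x
  sum_one : ∑ x, w x = 1

/-- A function with values in `{0,1}` (an indicator). [this work] -/
def IsIndicator (g : X → ℝ) : Prop := ∀ x, g x = 0 ∨ g x = 1

/-- Harris' inequality for the weight `w` on the preorder `X`: `E f · E g ≤ E (f·g)` for all monotone `f, g`.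
[folklore] (Harris 1960 / Kleitman 1966 for product measures on Boolean cubes) -/
def IsHarris [Preorder X] (w : X → ℝ) : Prop :=
  ∀ f g : X → ℝ, Monotone f → Monotone g → ex w f * ex w g ≤ ex w (f * g)

/-- `ex` is linear: additivity. [this work] -/
theorem ex_add (w f g : X → ℝ) : ex w (f + g) = ex w f + ex w g := by
  unfold ex; rw [← sum_add_distrib]; exact sum_congr rfl fun x _ => by simp [mul_add]

/-- `ex` is linear: subtraction. [this work] -/
theorem ex_sub (w f g : X → ℝ) : ex w (f - g) = ex w f - ex w g := by
  unfold ex; rw [← sum_sub_distrib]; exact sum_congr rfl fun x _ => by simp [mul_sub]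

/-- `ex` is linear: scalars. [this work] -/
theorem ex_smul (w f : X → ℝ) (c : ℝ) : ex w (fun x => c * f x) = c * ex w f := by
  unfold ex; rw [mul_sum]; exact sum_congr rfl fun x _ => by ring

/-- Expectation of a constant under a probability weight. [this work] -/
theorem ex_const {w : X → ℝ} (hw : IsProbWeight w) (c : ℝ) : ex w (fun _ => c) = c := by
  unfold ex; rw [← sum_mul, hw.sum_one, one_mul]

/-- `ex` is monotone in the function when the weight is nonnegative. [this work] -/
theorem ex_mono {w : X → ℝ} (hw : ∀ x, 0 ≤ w x) {f g : X → ℝ} (h : ∀ x, f x ≤ g x) : ex w f ≤ ex w g :=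
  sum_le_sum fun x _ => mul_le_mul_of_nonneg_left (h x) (hw x)

/-- `ex` of a nonnegative function under a nonnegative weight is nonnegative. [this work] -/
theorem ex_nonneg {w : X → ℝ} (hw : ∀ x, 0 ≤ w x) {f : X → ℝ} (h : ∀ x, 0 ≤ f x) : 0 ≤ ex w f :=
  sum_nonneg fun x _ => mul_nonneg (hw x) (h x)

/-- Under a probability weight, `E f ≤ 1` when `f ≤ 1`. [this work] -/
theorem ex_le_one {w : X → ℝ} (hw : IsProbWeight w) {f : X → ℝ} (h : ∀ x, f x ≤ 1) : ex w f ≤ 1 := by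
  calc ex w f ≤ ex w (fun _ => (1 : ℝ)) := ex_mono hw.nonneg h
    _ = 1 := ex_const hw 1

/-- Harris in covariance form for a probability weight: `E f · E g ≤ E(f g)`, restated with the constant pulled in:
`0 ≤ E (f · (g − E g))`. [this work] -/
theorem IsHarris.ex_mul_sub_nonneg [Preorder X] {w : X → ℝ} (hH : IsHarris w) {f g : X → ℝ}
    (hf : Monotone f) (hg : Monotone g) : 0 ≤ ex w (fun x => f x * (g x - ex w g)) := by
  have h := hH f g hf hg
  have : ex w (fun x => f x * (g x - ex w g)) = ex w (f * g) - ex w f * ex w g := by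
    unfold ex; simp only [Pi.mul_apply, mul_sub, sum_sub_distrib]
    rw [show ∑ x, w x * (f x * ∑ x, w x * g x) = (∑ x, w x * f x) * ∑ x, w x * g x by rw [sum_mul]; exact sum_congr rfl fun x _ => by ring]
  rw [this]; linarith

/-! ## Indicators -/

namespace IsIndicator

variable {g : X → ℝ}

omit [Fintype X] in
/-- An indicator is nonnegative. [this work] -/
theorem nonneg (hg : IsIndicator g) (x : X) : 0 ≤ g x := by rcases hg x with h | h <;> simp [h]

omit [Fintype X] in
/-- An indicator is at most `1`. [this work] -/
theorem le_one (hg : IsIndicator g) (x : X) : g x ≤ 1 := by rcases hg x with h | h <;> simp [h]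

omit [Fintype X] in
/-- An indicator is idempotent: `g² = g`. [this work] -/
theorem mul_self (hg : IsIndicator g) (x : X) : g x * g x = g x := by rcases hg x with h | h <;> simp [h]

omit [Fintype X] in
/-- The product of two indicators is an indicator. [this work] -/
theorem mul {h : X → ℝ} (hg : IsIndicator g) (hh : IsIndicator h) : IsIndicator (g * h) := fun x => by
  rcases hg x with a | a <;> rcases hh x with b | b <;> simp [a, b]

end IsIndicator

/-- Under a probability weight an indicator has expectation in `[0,1]`. [this work] -/
theorem ex_indicator_mem {w : X → ℝ} (hw : IsProbWeight w) {g : X → ℝ} (hg : IsIndicator g) :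
    0 ≤ ex w g ∧ ex w g ≤ 1 := ⟨ex_nonneg hw.nonneg hg.nonneg, ex_le_one hw hg.le_one⟩

/-! ## Sahi's third-order functional and Kahn pairs -/

/-- **Sahi's `E₃`** of three functions under the weight `w`:
`2E(fgh) − E(fg)E(h) − E(fh)E(g) − E(gh)E(f) + E(f)E(g)E(h)` [Sahi 2008, (7); Lieb–Sahi 2021, (2.1); Kahn 2022, Conj. 5 for
indicators]. [this work] -/
def kahnK (w : X → ℝ) (f g h : X → ℝ) : ℝ :=
  2 * ex w (f * g * h) - ex w (f * g) * ex w h - ex w (f * h) * ex w g - ex w (g * h) * ex w f + ex w f * ex w g * ex w h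

/-- **Kahn's inequality for the pair `(g,h)`**: `E₃(f,g,h) ≥ 0` for every monotone test function `f ≥ 0` (for indicators of
up-sets `g = 1_B`, `h = 1_C` this is Kahn's Conjecture 5 for `(A,B,C)` with `A` ranging over ALL increasing events). [this work] -/
def KahnPair [Preorder X] (w : X → ℝ) (g h : X → ℝ) : Prop :=
  ∀ f : X → ℝ, Monotone f → (∀ x, 0 ≤ f x) → 0 ≤ kahnK w f g h

/-- `E₃` is symmetric in its last two arguments. [this work] -/
theorem kahnK_comm₂₃ (w f g h : X → ℝ) : kahnK w f g h = kahnK w f h g := by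
  unfold kahnK
  rw [show f * g * h = f * h * g from by ext x; simp [mul_right_comm], show g * h = h * g from mul_comm g h]
  ring

/-- `KahnPair` is symmetric. [this work] -/
theorem KahnPair.symm [Preorder X] {w g h : X → ℝ} (hK : KahnPair w g h) : KahnPair w h g :=
  fun f hf hf0 => by rw [kahnK_comm₂₃]; exact hK f hf hf0

/-- **The nested case.** On a Harris probability space, `E₃(f,g,h) ≥ 0` for all monotone `f ≥ 0` whenever `g ≤ h` are
monotone indicators: `E₃ = (2 − c)E(fg) − b E(fh) − b(1−c)E f ≥ b(E f − E(fh)) ≥ 0` (`b = E g`, `c = E h`, using `g h = g`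
and Harris for `(f,g)`).  [folklore; the nested/principal mechanism of Sahi 2008 Thm. 2 / Blinovsky 2013] -/
theorem kahnPair_of_le [Preorder X] {w : X → ℝ} (hw : IsProbWeight w) (hH : IsHarris w) {g h : X → ℝ}
    (hg : IsIndicator g) (hh : IsIndicator h) (hgm : Monotone g) (hle : ∀ x, g x ≤ h x) : KahnPair w g h := by
  intro f hf hf0
  have hgh : g * h = g := by
    ext x; rcases hg x with a | a
    · simp [a]
    · have : h x = 1 := by rcases hh x with b | b <;> [linarith [hle x]; exact b]
      simp [a, this]
  have hfgh : f * g * h = f * g := by rw [mul_assoc, hgh]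
  have hHar : ex w f * ex w g ≤ ex w (f * g) := hH f g hf hgm
  have hb := ex_indicator_mem hw hg
  have hc := ex_indicator_mem hw hh
  have hfh : ex w (f * h) ≤ ex w f := ex_mono hw.nonneg fun x => by
    simpa using mul_le_of_le_one_right (hf0 x) (hh.le_one x)
  have hf' : 0 ≤ ex w f := ex_nonneg hw.nonneg hf0
  unfold kahnK; rw [hfgh, hgh]
  nlinarith [mul_le_mul_of_nonneg_left hfh hb.1, mul_le_mul_of_nonneg_right hHar (by linarith [hc.2] : (0:ℝ) ≤ 2 - ex w h),
    mul_nonneg hb.1 (sub_nonneg.2 hc.2)]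

/-- The trivial pair `(0, h)`: `E₃(f,0,h) = 0`. [this work] -/
theorem kahnPair_zero_left [Preorder X] (w h : X → ℝ) : KahnPair w 0 h := by
  intro f _ _; unfold kahnK ex; simp

/-- The trivial pair `(1, h)`: `E₃(f,1,h) = E(fh) − E f · E h ≥ 0` is Harris' inequality. [this work] -/
theorem kahnPair_one_left [Preorder X] {w : X → ℝ} (hw : IsProbWeight w) (hH : IsHarris w) {h : X → ℝ}
    (hh : Monotone h) : KahnPair w 1 h := by
  intro f hf _
  have h1 : ex w (1 : X → ℝ) = 1 := ex_const hw 1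
  have := hH f h hf hh
  unfold kahnK; simp only [mul_one, one_mul, h1]; nlinarith [this]

/-! ## Products: the old space `X` times a fresh module `Y` -/

/-- The product weight on `X × Y`. [this work] -/
def prodW (w : X → ℝ) (w' : Y → ℝ) : X × Y → ℝ := fun z => w z.1 * w' z.2

/-- The product of probability weights is a probability weight. [this work] -/
theorem isProbWeight_prodW {w : X → ℝ} {w' : Y → ℝ} (hw : IsProbWeight w) (hw' : IsProbWeight w') :
    IsProbWeight (prodW w w') where
  nonneg z := mul_nonneg (hw.nonneg z.1) (hw'.nonneg z.2)
  sum_one := by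
    unfold prodW; rw [Fintype.sum_prod_type_right]
    simp_rw [← sum_mul, hw.sum_one, one_mul, hw'.sum_one]

/-- **Iterated expectation**: `E_{X×Y} F = E_Y (y ↦ E_X F(·,y))`. [this work] -/
theorem ex_prodW (w : X → ℝ) (w' : Y → ℝ) (F : X × Y → ℝ) :
    ex (prodW w w') F = ex w' (fun y => ex w (fun x => F (x, y))) := by
  unfold ex prodW; rw [Fintype.sum_prod_type_right]
  exact sum_congr rfl fun y _ => by rw [mul_sum]; exact sum_congr rfl fun x _ => by ring

omit [Fintype X] [Fintype Y] in
/-- A fibre `x ↦ F(x,y)` of a monotone function is monotone. [this work] -/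
theorem monotone_fibre_left [Preorder X] [Preorder Y] {F : X × Y → ℝ} (hF : Monotone F) (y : Y) :
    Monotone fun x => F (x, y) := fun _ _ hab => hF (Prod.mk_le_mk.2 ⟨hab, le_rfl⟩)

omit [Fintype X] [Fintype Y] in
/-- A fibre `y ↦ F(x,y)` of a monotone function is monotone. [this work] -/
theorem monotone_fibre_right [Preorder X] [Preorder Y] {F : X × Y → ℝ} (hF : Monotone F) (x : X) :
    Monotone fun y => F (x, y) := fun _ _ hab => hF (Prod.mk_le_mk.2 ⟨le_rfl, hab⟩)

omit [Fintype Y] in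
/-- Fibre expectations of a monotone function are monotone (nonnegative weight). [this work] -/
theorem monotone_ex_fibre [Preorder X] [Preorder Y] {w : X → ℝ} (hw : ∀ x, 0 ≤ w x) {F : X × Y → ℝ}
    (hF : Monotone F) : Monotone fun y => ex w (fun x => F (x, y)) :=
  fun _ _ hab => ex_mono hw fun x => monotone_fibre_right hF x hab

/-- **The product of two Harris probability spaces is Harris** (Harris 1960's induction step, for finite weighted preorders):
`E(FG) = E_Y E_X(F_y G_y) ≥ E_Y (E_X F_y · E_X G_y) ≥ E_Y E_X F_y · E_Y E_X G_y`. [folklore] -/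
theorem isHarris_prodW [Preorder X] [Preorder Y] {w : X → ℝ} {w' : Y → ℝ} (hw : IsProbWeight w)
    (hw' : IsProbWeight w') (hX : IsHarris w) (hY : IsHarris w') : IsHarris (prodW w w') := by
  intro F G hF hG
  rw [ex_prodW, ex_prodW, ex_prodW]
  calc ex w' (fun y => ex w fun x => F (x, y)) * ex w' (fun y => ex w fun x => G (x, y))
      ≤ ex w' ((fun y => ex w fun x => F (x, y)) * fun y => ex w fun x => G (x, y)) :=
        hY _ _ (monotone_ex_fibre hw.nonneg hF) (monotone_ex_fibre hw.nonneg hG)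
    _ ≤ ex w' (fun y => ex w fun x => (F * G) (x, y)) :=
        ex_mono hw'.nonneg fun y => hX _ _ (monotone_fibre_left hF y) (monotone_fibre_left hG y)

/-- **A two-point space is Harris**: on `Bool` (with `false < true`) and any probability weight,
`E(fg) − E f E g = w ff · w tt · (f tt − f ff)(g tt − g ff) ≥ 0` for monotone `f, g`. [folklore] -/
theorem isHarris_bool {w : Bool → ℝ} (hw : IsProbWeight w) : IsHarris w := by
  intro f g hf hg
  have h1 : w false + w true = 1 := by simpa [Fintype.sum_bool, add_comm] using hw.sum_one
  have hf' : f false ≤ f true := hf (by decide)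
  have hg' : g false ≤ g true := hg (by decide)
  unfold ex; simp only [Fintype.sum_bool, Pi.mul_apply]
  have key : (w true * (f true * g true) + w false * (f false * g false)) -
      (w true * f true + w false * f false) * (w true * g true + w false * g false) =
      w false * w true * ((f true - f false) * (g true - g false)) := by
    have : w false = 1 - w true := by linarith
    rw [this]; ring
  nlinarith [key, mul_nonneg (mul_nonneg (hw.nonneg false) (hw.nonneg true)) (mul_nonneg (sub_nonneg.2 hf') (sub_nonneg.2 hg'))]

/-! ## Lifting functions from the factors -/

/-- Lift of a function on the old space `X` to `X × Y`. [this work] -/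
def liftX (g : X → ℝ) : X × Y → ℝ := fun z => g z.1

/-- Lift of a function on the module `Y` to `X × Y`. [this work] -/
def liftY (v : Y → ℝ) : X × Y → ℝ := fun z => v z.2

omit [Fintype X] [Fintype Y] in
/-- `liftX` of a monotone function is monotone. [this work] -/
theorem monotone_liftX [Preorder X] [Preorder Y] {g : X → ℝ} (hg : Monotone g) : Monotone (liftX (Y := Y) g) :=
  fun _ _ hab => hg (Prod.mk_le_mk.1 hab).1

omit [Fintype X] [Fintype Y] in
/-- `liftY` of a monotone function is monotone. [this work] -/
theorem monotone_liftY [Preorder X] [Preorder Y] {v : Y → ℝ} (hv : Monotone v) : Monotone (liftY (X := X) v) :=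
  fun _ _ hab => hv (Prod.mk_le_mk.1 hab).2

omit [Fintype X] [Fintype Y] in
/-- `liftX` of an indicator is an indicator. [this work] -/
theorem isIndicator_liftX {g : X → ℝ} (hg : IsIndicator g) : IsIndicator (liftX (Y := Y) g) := fun z => hg z.1

omit [Fintype X] [Fintype Y] in
/-- `liftY` of an indicator is an indicator. [this work] -/
theorem isIndicator_liftY {v : Y → ℝ} (hv : IsIndicator v) : IsIndicator (liftY (X := X) v) := fun z => hv z.2

/-- Linearity of the outer expectation in the fibrewise form of `E₃` (bookkeeping). [this work] -/
theorem ex_kahnK_lin (w' : Y → ℝ) (D G H a : Y → ℝ) (b c d : ℝ) :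
    ex w' (fun y => 2 * D y - G y * c - H y * b - d * a y + a y * b * c) =
      2 * ex w' D - ex w' G * c - ex w' H * b - d * ex w' a + ex w' a * b * c := by
  simp only [ex, mul_sum, sum_mul, ← sum_sub_distrib, ← sum_add_distrib]
  exact sum_congr rfl fun y _ => by ring

/-- **Fibrewise form of `E₃` for lifted `g, h`**: when `g, h` live on the old space `X`,
`E₃(F, g̃, h̃) = E_Y ( y ↦ E₃_X(F(·,y), g, h) )`. [this work] -/
theorem kahnK_liftX_liftX [Preorder X] [Preorder Y] {w : X → ℝ} {w' : Y → ℝ} (hw' : IsProbWeight w')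
    (F : X × Y → ℝ) (g h : X → ℝ) :
    kahnK (prodW w w') F (liftX g) (liftX h) = ex w' (fun y => kahnK w (fun x => F (x, y)) g h) := by
  have eg : ex (prodW w w') (liftX (Y := Y) g) = ex w g := by
    rw [ex_prodW]; exact ex_const hw' (ex w g)
  have eh : ex (prodW w w') (liftX (Y := Y) h) = ex w h := by
    rw [ex_prodW]; exact ex_const hw' (ex w h)
  have egh : ex (prodW w w') (liftX (Y := Y) g * liftX h) = ex w (g * h) := by
    rw [ex_prodW]; exact ex_const hw' (ex w (g * h))
  have e1 : ex (prodW w w') (F * liftX g * liftX h) = ex w' (fun y => ex w ((fun x => F (x, y)) * g * h)) := by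
    rw [ex_prodW]; rfl
  have e2 : ex (prodW w w') (F * liftX g) = ex w' (fun y => ex w ((fun x => F (x, y)) * g)) := by rw [ex_prodW]; rfl
  have e3 : ex (prodW w w') (F * liftX h) = ex w' (fun y => ex w ((fun x => F (x, y)) * h)) := by rw [ex_prodW]; rfl
  have e4 : ex (prodW w w') F = ex w' (fun y => ex w (fun x => F (x, y))) := ex_prodW _ _ _
  unfold kahnK
  rw [e1, e2, e3, e4, eg, eh, egh, ← ex_kahnK_lin]

/-- **Dummy coordinates**: a Kahn pair on `X` stays a Kahn pair after adding an independent module on which neither function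
depends (`E₃` is computed fibrewise and each fibre is an instance of the hypothesis). [this work] -/
theorem kahnPair_liftX [Preorder X] [Preorder Y] {w : X → ℝ} {w' : Y → ℝ} (hw' : IsProbWeight w')
    {g h : X → ℝ} (hK : KahnPair w g h) : KahnPair (prodW w w') (liftX g) (liftX h) := by
  intro F hF hF0
  rw [kahnK_liftX_liftX hw']
  exact ex_nonneg hw'.nonneg fun y => hK _ (monotone_fibre_left hF y) fun x => hF0 (x, y)

end Summit.CriticalPhenomena.PercolationContinuityZ3.Theorems.SahiKahnModule
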